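import Literature.AnabelianGeometry.SemiGraphs.TemperedReconstructionR0CompatProofs
import Literature.AnabelianGeometry.SemiGraphs.TemperedThm37OfCompactInVerticial
import HarnessLib

/-!
# [SemiAnbd] Def. 3.8 / Cor. 3.9: quasi-geometric homomorphisms COMPOSE (proof-only)

Mochizuki, *Semi-graphs of anabelioids*, Publ. RIMS **42** (2006), §3, Def. 3.8 and the proof of
Cor. 3.9, p. 268 ("a quasi-geometric `φ` determines a map on the underlying graphs `G → H` that is
functorial in `φ`" — presupposing that quasi-geometric morphisms of temperoids form a category)
[cite: MochizukiSemiAnbd2006, Cor 3.9 pp.42-43].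

* `IsQuasiGeometric.comp` — PURE GROUP THEORY: if `φ₁ : Π₁ → Π₂` and `φ₂ : Π₂ → Π₃` are
  quasi-geometric (Def. 3.8 as typed) then so is `φ₂ ∘ φ₁` ("maps onto an open subgroup of" composes:
  `MapsOntoOpenSubgroupOf.comp`, via `Subgroup.relIndex_map_map_ne_zero'`).
* `IsCompatiblyQuasiGeometric.comp` — the compatible reading (ruling χ2) composes as soon as the
  nontrivial intersections of distinct maximal compact subgroups of the MIDDLE group are infinite
  (so that the image of `K₁ ∩ H₁`, open in such an intersection, is nontrivial); for `Π₂ = π₁^temp(H)`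
  with `H` as in Cor. 3.9 this holds by Thm. 3.7 (iv) (edge-like subgroups are infinite: total
  elevation), whence `IsCompatiblyQuasiGeometric.comp_of_compactInVerticial` modulo Thm. 3.7 (iii).

Together with `base_comp_of_compatV` (`TemperedReconstructionFunctorialityProofs.lean`) and the
bijection `cor39UpToTwist_of_compactInVerticial` this is the category-level content of Cor. 3.9.
Nothing here takes a side on [IUTchIII] Cor. 3.12; typed ≠ discharged.
-/

namespace Literature.AnabelianGeometry.SemiGraphs

universe u

/-! ### Group theory: "maps onto an open subgroup of" composes -/

section GroupTheory

variable {G₁ : Type u} [Group G₁] {G₂ : Type u} [Group G₂] [TopologicalSpace G₂]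
  {G₃ : Type u} [Group G₃] [TopologicalSpace G₃]

/-- Finite relative index passes to images: if `[K : H ∩ K] < ∞` then `[f(K) : f(H) ∩ f(K)] < ∞`.
[folklore] -/
private theorem relIndex_map_map_ne_zero' {G G' : Type*} [Group G] [Group G'] (f : G →* G')
    {H K : Subgroup G} (h : H.relIndex K ≠ 0) : (H.map f).relIndex (K.map f) ≠ 0 := by
  let fK : K →* G' := f.comp K.subtype
  have hK : K.map f = (⊤ : Subgroup K).map fK := by
    rw [← MonoidHom.range_eq_map, ← MonoidHom.map_range, Subgroup.range_subtype]
  have h1 : (H.map f).relIndex (K.map f) = (Subgroup.comap fK (H.map f)).index := by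
    rw [hK, ← Subgroup.relIndex_comap, Subgroup.relIndex_top_right]
  have h2 : H.subgroupOf K ≤ Subgroup.comap fK (H.map f) := fun x hx => ⟨x.1, hx, rfl⟩
  rw [h1]
  intro h0
  have hd := Subgroup.index_dvd_of_le h2
  rw [h0] at hd
  exact h (Nat.eq_zero_of_zero_dvd hd)

/-- A subgroup mapped onto an open subgroup of a compact `K₂` has compact image (an open subgroup
of a compact group is closed). [cite: MochizukiSemiAnbd2006, Def 3.8 p.42] -/
theorem isCompact_map_of_mapsOntoOpenSubgroupOf [IsTopologicalGroup G₂] (φ : G₁ →* G₂) {K : Subgroup G₁}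
    {K₂ : Subgroup G₂} (hK₂ : IsCompact (K₂ : Set G₂)) (h : MapsOntoOpenSubgroupOf φ K K₂) :
    IsCompact (K.map φ : Set G₂) := by
  haveI : CompactSpace K₂ := isCompact_iff_compactSpace.mp hK₂
  have hcl : IsClosed (((K.map φ).subgroupOf K₂ : Subgroup K₂) : Set K₂) :=
    Subgroup.isClosed_of_isOpen _ h.2
  have himg : (K.map φ : Set G₂) = Subtype.val '' (((K.map φ).subgroupOf K₂ : Subgroup K₂) : Set K₂) := by
    ext y
    constructor
    · intro hy
      exact ⟨⟨y, h.1 hy⟩, hy, rfl⟩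
    · rintro ⟨x, hx, rfl⟩
      exact hx
  rw [himg]
  exact hcl.isCompact.image continuous_subtype_val

/-- Converse packaging: a CLOSED subgroup `φ(K) ≤ K₂` of finite index in `K₂` is open in `K₂`,
i.e. `φ` "maps `K` onto an open subgroup of `K₂`". [cite: MochizukiSemiAnbd2006, Def 3.8 p.42] -/
theorem mapsOntoOpenSubgroupOf_of_relIndex_ne_zero [IsTopologicalGroup G₂] (φ : G₁ →* G₂)
    {K : Subgroup G₁} {K₂ : Subgroup G₂} (hle : K.map φ ≤ K₂)
    (hrel : (K.map φ).relIndex K₂ ≠ 0) (hcl : IsClosed (K.map φ : Set G₂)) :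
    MapsOntoOpenSubgroupOf φ K K₂ := by
  refine ⟨hle, ?_⟩
  haveI : ((K.map φ).subgroupOf K₂).FiniteIndex := Subgroup.finiteIndex_iff.mpr hrel
  have h1 : IsClosed (((K.map φ).subgroupOf K₂ : Subgroup K₂) : Set K₂) :=
    hcl.preimage continuous_subtype_val
  exact Subgroup.isOpen_of_isClosed_of_finiteIndex _ h1

/-- **"Maps onto an open subgroup of" composes** (for compact targets): if `φ₁` maps `K₁` onto an
open subgroup of the compact `K₂` and `φ₂` maps `K₂` onto an open subgroup of the compact `K₃`,
then `φ₂ ∘ φ₁` maps `K₁` onto an open subgroup of `K₃`. [cite: MochizukiSemiAnbd2006, Def 3.8 p.42] -/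
theorem MapsOntoOpenSubgroupOf.comp [TopologicalSpace G₁] [IsTopologicalGroup G₂]
    [IsTopologicalGroup G₃] [T2Space G₃] (φ₁ : G₁ →ₜ* G₂) (φ₂ : G₂ →ₜ* G₃) {K₁ : Subgroup G₁}
    {K₂ : Subgroup G₂} {K₃ : Subgroup G₃} (hK₂ : IsCompact (K₂ : Set G₂))
    (hK₃ : IsCompact (K₃ : Set G₃)) (h₁ : MapsOntoOpenSubgroupOf φ₁.toMonoidHom K₁ K₂)
    (h₂ : MapsOntoOpenSubgroupOf φ₂.toMonoidHom K₂ K₃) :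
    MapsOntoOpenSubgroupOf (φ₂.comp φ₁).toMonoidHom K₁ K₃ := by
  have hmap : K₁.map (φ₂.comp φ₁).toMonoidHom = (K₁.map φ₁.toMonoidHom).map φ₂.toMonoidHom := by
    rw [Subgroup.map_map]; rfl
  refine mapsOntoOpenSubgroupOf_of_relIndex_ne_zero _ ?_ ?_ ?_
  · rw [hmap]; exact (Subgroup.map_mono h₁.1).trans h₂.1
  · rw [hmap]
    exact Subgroup.relIndex_ne_zero_trans
      (relIndex_map_map_ne_zero' φ₂.toMonoidHom (ProfiniteSemiGraph.relIndex_ne_zero_of_mapsOnto φ₁.toMonoidHom hK₂ h₁))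
      (ProfiniteSemiGraph.relIndex_ne_zero_of_mapsOnto φ₂.toMonoidHom hK₃ h₂)
  · rw [hmap]
    exact ((isCompact_map_of_mapsOntoOpenSubgroupOf φ₁.toMonoidHom hK₂ h₁).image
      φ₂.continuous).isClosed

/-- An open subgroup of an INFINITE compact subgroup is nontrivial: if `φ` maps `K` onto an open
subgroup of a compact infinite `K₂`, then `φ(K) ≠ 1`. [cite: MochizukiSemiAnbd2006, Def 3.8 p.42] -/
theorem map_ne_bot_of_mapsOntoOpenSubgroupOf [IsTopologicalGroup G₂] (φ : G₁ →* G₂)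
    {K : Subgroup G₁} {K₂ : Subgroup G₂}
    (hK₂ : IsCompact (K₂ : Set G₂)) (hinf : (K₂ : Set G₂).Infinite)
    (h : MapsOntoOpenSubgroupOf φ K K₂) : K.map φ ≠ ⊥ := by
  intro h0
  have hrel := ProfiniteSemiGraph.relIndex_ne_zero_of_mapsOnto φ hK₂ h
  rw [h0, Subgroup.relIndex_bot_left] at hrel
  exact hinf (Set.finite_coe_iff.mp (Nat.finite_of_card_ne_zero hrel))

/-! ### Def. 3.8 composes -/

/-- The intersection of two compact subgroups of a Hausdorff group is compact. [folklore] -/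
private theorem isCompact_inf [T2Space G₂] {K H : Subgroup G₂} (hK : IsCompact (K : Set G₂))
    (hH : IsCompact (H : Set G₂)) : IsCompact ((K ⊓ H : Subgroup G₂) : Set G₂) := by
  rw [Subgroup.coe_inf]
  exact hK.inter_right hH.isClosed

/-- **Quasi-geometric homomorphisms compose** (Def. 3.8 as typed; pure group theory).
[cite: MochizukiSemiAnbd2006, Def 3.8 p.42] -/
theorem IsQuasiGeometric.comp [TopologicalSpace G₁] [IsTopologicalGroup G₂] [T2Space G₂]
    [IsTopologicalGroup G₃] [T2Space G₃] {φ₁ : G₁ →ₜ* G₂} {φ₂ : G₂ →ₜ* G₃}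
    (h₁ : IsQuasiGeometric φ₁) (h₂ : IsQuasiGeometric φ₂) : IsQuasiGeometric (φ₂.comp φ₁) := by
  refine ⟨fun K₁ hK₁ => ?_, fun K₁ H₁ hK₁ hH₁ hne hnt => ?_⟩
  · obtain ⟨K₂, hK₂, hm₁⟩ := h₁.maximal K₁ hK₁
    obtain ⟨K₃, hK₃, hm₂⟩ := h₂.maximal K₂ hK₂
    exact ⟨K₃, hK₃, MapsOntoOpenSubgroupOf.comp φ₁ φ₂ hK₂.1 hK₃.1 hm₁ hm₂⟩
  · obtain ⟨K₂, H₂, hK₂, hH₂, hne₂, hnt₂, hm₁⟩ := h₁.inter K₁ H₁ hK₁ hH₁ hne hnt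
    obtain ⟨K₃, H₃, hK₃, hH₃, hne₃, hnt₃, hm₂⟩ := h₂.inter K₂ H₂ hK₂ hH₂ hne₂ hnt₂
    exact ⟨K₃, H₃, hK₃, hH₃, hne₃, hnt₃,
      MapsOntoOpenSubgroupOf.comp φ₁ φ₂ (isCompact_inf hK₂.1 hH₂.1) (isCompact_inf hK₃.1 hH₃.1) hm₁ hm₂⟩

/-- **Compatibly quasi-geometric homomorphisms compose** when the nontrivial intersections of two
distinct maximal compact subgroups of the middle group are infinite (for `π₁^temp(H)`: the edge-like
subgroups, Thm. 3.7 (iv)). [cite: MochizukiSemiAnbd2006, Cor 3.9 pp.42-43] -/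
theorem IsCompatiblyQuasiGeometric.comp [TopologicalSpace G₁] [IsTopologicalGroup G₂] [T2Space G₂]
    [IsTopologicalGroup G₃] [T2Space G₃] {φ₁ : G₁ →ₜ* G₂} {φ₂ : G₂ →ₜ* G₃}
    (hinf : ∀ K₂ H₂ : Subgroup G₂, IsMaximalCompactSubgroup K₂ → IsMaximalCompactSubgroup H₂ →
      K₂ ≠ H₂ → K₂ ⊓ H₂ ≠ ⊥ → ((K₂ ⊓ H₂ : Subgroup G₂) : Set G₂).Infinite)
    (h₁ : IsCompatiblyQuasiGeometric φ₁) (h₂ : IsCompatiblyQuasiGeometric φ₂) :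
    IsCompatiblyQuasiGeometric (φ₂.comp φ₁) := by
  refine ⟨h₁.isQuasiGeometric.comp h₂.isQuasiGeometric, fun K₁ H₁ hK₁ hH₁ hne hnt => ?_⟩
  obtain ⟨K₂, H₂, hK₂, hH₂, hne₂, hle₁, hle₂⟩ := h₁.compat K₁ H₁ hK₁ hH₁ hne hnt
  -- the image of `K₁ ∩ H₁` is nontrivial: it is open in an (infinite) nontrivial intersection
  obtain ⟨K₂', H₂', hK₂', hH₂', hne₂', hnt₂', hm⟩ := h₁.isQuasiGeometric.inter K₁ H₁ hK₁ hH₁ hne hnt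
  have hL : (K₁ ⊓ H₁).map φ₁.toMonoidHom ≠ ⊥ :=
    map_ne_bot_of_mapsOntoOpenSubgroupOf φ₁.toMonoidHom (isCompact_inf hK₂'.1 hH₂'.1)
      (hinf K₂' H₂' hK₂' hH₂' hne₂' hnt₂') hm
  have hnt₂ : K₂ ⊓ H₂ ≠ ⊥ := fun h0 => hL (by
    rw [eq_bot_iff, ← h0]
    exact le_inf ((Subgroup.map_mono inf_le_left).trans hle₁)
      ((Subgroup.map_mono inf_le_right).trans hle₂))
  obtain ⟨K₃, H₃, hK₃, hH₃, hne₃, hle₁', hle₂'⟩ := h₂.compat K₂ H₂ hK₂ hH₂ hne₂ hnt₂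
  refine ⟨K₃, H₃, hK₃, hH₃, hne₃, ?_, ?_⟩
  · change K₁.map (φ₂.toMonoidHom.comp φ₁.toMonoidHom) ≤ K₃
    rw [← Subgroup.map_map]
    exact (Subgroup.map_mono hle₁).trans hle₁'
  · change H₁.map (φ₂.toMonoidHom.comp φ₁.toMonoidHom) ≤ H₃
    rw [← Subgroup.map_map]
    exact (Subgroup.map_mono hle₂).trans hle₂'

end GroupTheory

/-! ### The middle group `π₁^temp(H)`: edge-like subgroups are infinite -/

namespace ProfiniteSemiGraph

variable {ℋ : ProfiniteSemiGraph.{u}}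

/-- Under the hypotheses of Cor. 3.9 and Thm. 3.7 (iv), a nontrivial intersection of two distinct
maximal compact subgroups of `π₁^temp(H)` — an edge-like subgroup — is INFINITE (total elevation:
`Π_b` is infinite and `ψ_v ∘ b_*` is injective). [cite: MochizukiSemiAnbd2006, Thm 3.7(iv) p.41] -/
theorem infinite_inf_of_isMaximalCompactSubgroup (h37iv : MaximalCompactIffVerticial.{u})
    (hℋ : Cor39Hypotheses ℋ) (c : TemperedPiChart ℋ) (K H : Subgroup c.G)
    (hK : IsMaximalCompactSubgroup K) (hH : IsMaximalCompactSubgroup H) (hne : K ≠ H)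
    (hnt : K ⊓ H ≠ ⊥) : ((K ⊓ H : Subgroup c.G) : Set c.G).Infinite := by
  classical
  have hℋ37 := hℋ.thm37Hypotheses
  obtain ⟨-, hint⟩ := h37iv ℋ hℋ37 c
  choose ψ hψ using exists_isVerticialHom_of_thm37i verticialInjective_holds hℋ37 c
  obtain ⟨e, he, hL⟩ := (hint (K ⊓ H) hnt).mp ⟨K, H, hK, hH, hne, rfl⟩
  obtain ⟨b, -, v, -, -, q, -, hv, -⟩ := SemiGraph.exists_branches_of_isClosedEdge he
  obtain ⟨g, hLg⟩ := edgeLike_eq_map_branchSubgroup c hv (q ▸ hL) (ψ v) (hψ v)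
  haveI := infinite_branchSubgroup hℋ37.toProp36Hypotheses hv
  -- `x ↦ g ψ(x) g⁻¹` injects the infinite branch subgroup into `K ∩ H`
  let f : ℋ.branchSubgroup b v hv → (K ⊓ H : Subgroup c.G) := fun x =>
    ⟨g * ψ v x.1 * g⁻¹, hLg ▸ ⟨ψ v x.1, ⟨x.1, x.2, rfl⟩, rfl⟩⟩
  have hf : Function.Injective f := by
    intro x y hxy
    have h1 : g * ψ v x.1 * g⁻¹ = g * ψ v y.1 * g⁻¹ := congrArg Subtype.val hxy
    have h2 : ψ v x.1 = ψ v y.1 := by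
      simpa [mul_left_cancel_iff, mul_right_cancel_iff] using h1
    exact Subtype.ext ((verticialInjective_holds ℋ hℋ37 c v).2 (ψ v) (hψ v) h2)
  haveI : Infinite (K ⊓ H : Subgroup c.G) := Infinite.of_injective f hf
  exact Set.infinite_coe_iff.mp ‹_›

/-- **Compatibly quasi-geometric homomorphisms through `π₁^temp(H)` compose**, for `H` as in
Cor. 3.9, modulo Thm. 3.7 (iv). [cite: MochizukiSemiAnbd2006, Cor 3.9 pp.42-43] -/
theorem _root_.Literature.AnabelianGeometry.SemiGraphs.IsCompatiblyQuasiGeometric.comp_of_maximalCompactIffVerticial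
    (h37iv : MaximalCompactIffVerticial.{u}) (hℋ : Cor39Hypotheses ℋ) (c : TemperedPiChart ℋ)
    {G₁ : Type u} [Group G₁] [TopologicalSpace G₁] {G₃ : Type u} [Group G₃] [TopologicalSpace G₃]
    [IsTopologicalGroup G₃] [T2Space G₃] {φ₁ : G₁ →ₜ* c.G} {φ₂ : c.G →ₜ* G₃}
    (h₁ : IsCompatiblyQuasiGeometric φ₁) (h₂ : IsCompatiblyQuasiGeometric φ₂) :
    IsCompatiblyQuasiGeometric (φ₂.comp φ₁) := by
  haveI := TemperedPiChart.t2Space c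
  exact h₁.comp (infinite_inf_of_isMaximalCompactSubgroup h37iv hℋ c) h₂

/-- The same modulo Thm. 3.7 (iii) `CompactInVerticial` alone (t11's
`maximalCompactIffVerticial_of_compactInVerticial`). [cite: MochizukiSemiAnbd2006, Cor 3.9 pp.42-43] -/
theorem _root_.Literature.AnabelianGeometry.SemiGraphs.IsCompatiblyQuasiGeometric.comp_of_compactInVerticial (h37iii : CompactInVerticial.{u})
    (hℋ : Cor39Hypotheses ℋ) (c : TemperedPiChart ℋ) {G₁ : Type u} [Group G₁] [TopologicalSpace G₁]
    {G₃ : Type u} [Group G₃] [TopologicalSpace G₃] [IsTopologicalGroup G₃] [T2Space G₃]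
    {φ₁ : G₁ →ₜ* c.G} {φ₂ : c.G →ₜ* G₃} (h₁ : IsCompatiblyQuasiGeometric φ₁)
    (h₂ : IsCompatiblyQuasiGeometric φ₂) : IsCompatiblyQuasiGeometric (φ₂.comp φ₁) :=
  h₁.comp_of_maximalCompactIffVerticial (maximalCompactIffVerticial_of_compactInVerticial h37iii) hℋ c h₂

end ProfiniteSemiGraph

end Literature.AnabelianGeometry.SemiGraphs
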